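import Summits.CriticalPhenomena.PercolationContinuityZ3.Theorems.Transplant.Slab111SK4Case
import Summits.CriticalPhenomena.PercolationContinuityZ3.Theorems.Transplant.Slab111SK4DefsX
import HarnessLib

/-!
# Small thickness `(111)`-films, radius FOUR, VII′: soundness of EXPLICIT-ROUTE plans and of the tagged certificates; the node clause from `CaseOKX`

builds on p205010 (kernel theorem, internal audit signed; external expert review pending) — NOT used in this file.  Lane `prim-bschramm`, seat
`prim-bschramm-p2` (gen 38; class C1b; memo `HOME/bschramm/P2-LATTICES.md` §136); helper file (`--supports stmt-CriticalPhenomena-4575 --as helper`).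
* §1 `RowOKX` / **`CaseOKX C`** (tagged: BFS or explicit plans) (every needed bit of every certified pair has a covering plan) and the soundness of the certificate readers of «Slab111SK4Defs»:
  `rdPlansX_sound`, `checkRowX_sound`, **`checkEsX_sound`** (a kernel-checked chunk `C.checkEsX es certs = true` gives `RowOKX` on the chunk), `caseOKX_of_chunks`;
* §2 the admissibility masks `allowedM` / `forcedM` of the instance's cleared mask (`Ctx4.wOK`);
* §3 **`linkage_of_caseOKX`**: `CaseOKX C` + `wOK` give the clause of `HexShadow.ShapedLinkage 4` («HexShadowVRouteData») for every block whose parameters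
  the case dominates, with the cleared set `Wset4 C z` («Slab111SK4Path»): terminals pass the filter («Slab111SK4Terms»), cover bits are swap pairs («Slab111SK4Plan»).
[cite: DuminilCopinSidoraviciusTassion2016, §2.3 (proof of Fact 2: the three disjoint paths in B_R(z))]
-/

noncomputable section

namespace Summit.CriticalPhenomena.PercolationContinuityZ3.Theorems.Transplant

open Literature.Probability.Percolation Literature.Probability.LatticeModels SimpleGraph
open scoped Classical

namespace Slab111.SK4

open Slab111.SK (ne_of_mem_tail ne_getLast_of_mem_dropLast mem_ne_ends eq_dropLast_append_of_getLast? eq_cons_tail_of_head? of_testBit_cond_not of_testBit_match_option bitOf sdiff maskBelow maskOfList endsOK orFold rd rdMask testBit_bitOf testBit_sdiff testBit_maskBelow of_testBit_maskBelow testBit_maskBelow_of testBit_foldl_or testBit_orFold testBit_maskOfList testBit_maskOfList_eq_false testBit_of_sdiff_eq_zero testBit_of_sdiff_beq testBit_false_of_land_eq_zero endsOK_sound sh_lev_of_adj triNorm_le_succ_of_adj)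

variable {C : Ctx4} {z : Site 2}

/-! ## §1 Case coverage and the certificate readers -/

/-- **Row coverage**: every needed bit of every partner of `e₁` has a covering plan. [folklore] -/
def RowOKX (C : Ctx4) (e1 : ℕ) : Prop :=
  ∀ e2 ∈ C.esList, e2 ≠ e1 → ∀ w, (C.needMask e1 e2).testBit w = true →
    (∃ c1 y b c2 av, (C.coverOf e1 e2 c1 y b c2 av).testBit w = true) ∨ (∃ c1 y b c2 A Y A2 B, (C.coverOfX e1 e2 c1 y b c2 A Y A2 B).testBit w = true)

/-- **Case coverage**: all rows. [folklore] -/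
def CaseOKX (C : Ctx4) : Prop := ∀ e1 ∈ C.esList, RowOKX C e1

/-- Soundness of the tagged plan reader: an accumulated bit comes from the accumulator, from a BFS plan, or from an explicit plan. [folklore] -/
theorem rdPlansX_sound (C : Ctx4) (e1 e2 w : ℕ) : ∀ (cnt n acc : ℕ), (C.rdPlansX e1 e2 cnt n acc).1.testBit w = true →
    acc.testBit w = true ∨ (∃ c1 y b c2 av, (C.coverOf e1 e2 c1 y b c2 av).testBit w = true) ∨
      (∃ c1 y b c2 A Y A2 B, (C.coverOfX e1 e2 c1 y b c2 A Y A2 B).testBit w = true)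
  | 0, _, _, h => Or.inl h
  | cnt + 1, n, acc, h => by
    simp only [Ctx4.rdPlansX] at h
    -- abbreviations for the two branches' accumulators
    have key : ∀ {m x : ℕ}, (bif x == 0 then acc else acc ||| x).testBit w = true → acc.testBit w = true ∨ x.testBit w = true := by
      intro m x hx
      cases hb : (x == 0)
      · rw [hb, cond_false, Nat.testBit_lor, Bool.or_eq_true] at hx; exact hx
      · rw [hb, cond_true] at hx; exact Or.inl hx
    cases ht : ((rd n).1 == 0)
    · rw [ht, cond_false] at h
      rcases rdPlansX_sound C e1 e2 w cnt _ _ h with h | h | h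
      · rcases key (m := 0) h with h | h
        · exact Or.inl h
        · exact Or.inr (Or.inr ⟨_, _, _, _, _, _, _, _, h⟩)
      · exact Or.inr (Or.inl h)
      · exact Or.inr (Or.inr h)
    · rw [ht, cond_true] at h
      rcases rdPlansX_sound C e1 e2 w cnt _ _ h with h | h | h
      · rcases key (m := 0) h with h | h
        · exact Or.inl h
        · exact Or.inr (Or.inl ⟨_, _, _, _, _, h⟩)
      · exact Or.inr (Or.inl h)
      · exact Or.inr (Or.inr h)

/-- **Soundness of the row checker.** [folklore] -/
theorem checkRowX_sound (C : Ctx4) (e1 : ℕ) : ∀ (es : List ℕ) (n : ℕ), C.checkRowX e1 es n = true →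
    ∀ e2 ∈ es, e2 ≠ e1 → ∀ w, (C.needMask e1 e2).testBit w = true →
      (∃ c1 y b c2 av, (C.coverOf e1 e2 c1 y b c2 av).testBit w = true) ∨ (∃ c1 y b c2 A Y A2 B, (C.coverOfX e1 e2 c1 y b c2 A Y A2 B).testBit w = true)
  | [], _, _ => fun _ h => nomatch h
  | e2 :: rest, n, h => by
    intro x hx hxe w hw
    simp only [Ctx4.checkRowX] at h
    by_cases he : e2 = e1
    · have hb : (e2 == e1) = true := by simp [he]
      rw [hb, cond_true] at h
      rcases List.mem_cons.1 hx with rfl | hx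
      · exact absurd he hxe
      · exact checkRowX_sound C e1 rest n h x hx hxe w hw
    · have hb : (e2 == e1) = false := by simp [he]
      rw [hb, cond_false] at h
      by_cases hn : C.needMask e1 e2 = 0
      · have hb2 : (C.needMask e1 e2 == 0) = true := by simp [hn]
        rw [hb2, cond_true] at h
        rcases List.mem_cons.1 hx with rfl | hx
        · rw [hn, Nat.zero_testBit] at hw; exact absurd hw Bool.false_ne_true
        · exact checkRowX_sound C e1 rest n h x hx hxe w hw
      · have hb2 : (C.needMask e1 e2 == 0) = false := by simp [hn]
        rw [hb2, cond_false] at h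
        try dsimp only at h
        generalize hr : C.rdPlansX e1 e2 (rd n).1 (rd n).2 0 = r at h
        cases hs : (sdiff (C.needMask e1 e2) r.1 == 0) with
        | false => rw [hs] at h; exact absurd h Bool.false_ne_true
        | true =>
          rw [hs, cond_true] at h
          rcases List.mem_cons.1 hx with rfl | hx
          · have hcov := testBit_of_sdiff_beq hs hw
            rw [← hr] at hcov
            rcases rdPlansX_sound C e1 _ w _ _ _ hcov with h0 | hp | hp
            · rw [Nat.zero_testBit] at h0; exact absurd h0 Bool.false_ne_true
            · exact Or.inl hp
            · exact Or.inr hp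
          · exact checkRowX_sound C e1 rest _ h x hx hxe w hw

/-- **SOUNDNESS OF A KERNEL-CHECKED CHUNK**: `C.checkEsX es certs = true` gives row coverage for every terminal of the chunk. [folklore] -/
theorem checkEsX_sound (C : Ctx4) : ∀ (es certs : List ℕ), C.checkEsX es certs = true → ∀ e1 ∈ es, RowOKX C e1
  | [], _, _ => fun _ h => nomatch h
  | e1 :: rest, certs, h => by
    intro x hx
    cases certs with
    | nil => simp [Ctx4.checkEsX] at h
    | cons n certs' =>
      simp only [Ctx4.checkEsX] at h
      cases hrow : C.checkRowX e1 C.esList n with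
      | false => rw [hrow] at h; exact absurd h Bool.false_ne_true
      | true =>
        rw [hrow, cond_true] at h
        rcases List.mem_cons.1 hx with rfl | hx
        · exact fun e2 he2 hne w hw => checkRowX_sound C x C.esList n hrow e2 he2 hne w hw
        · exact checkEsX_sound C rest certs' h x hx

/-- **Case coverage from chunks covering the terminal list.** [folklore] -/
theorem caseOKX_of_chunks (C : Ctx4) (chunks : List (List ℕ)) (h : ∀ ch ∈ chunks, ∀ e1 ∈ ch, RowOKX C e1)
    (hcov : (C.esList.all fun e => chunks.any fun ch => ch.elem e) = true) : CaseOKX C := by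
  intro e1 he1
  rw [List.all_eq_true] at hcov
  have := hcov e1 he1
  rw [List.any_eq_true] at this
  obtain ⟨ch, hch, hel⟩ := this
  exact h ch hch e1 (List.elem_iff.1 hel)

/-! ## §2′ Explicit plans are swap pairs -/

/-- **AN EXPLICIT-PLAN COVER BIT IS A SWAP PAIR.** [cite: DuminilCopinSidoraviciusTassion2016, §2.3 (proof of Fact 2)] -/
theorem coverOfX_sound (hz : ClassHyp4 C z) {tR sR : ℕ} (htR : C.tR = min tR 4) (hsR : C.sR = min sR 4)
    (hWv : ∀ i, C.W.testBit i = true → C.validB i = true) {e1 e2 w c1 y b c2 : ℕ} {A Y A2 B : List ℕ}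
    (h : (C.coverOfX e1 e2 c1 y b c2 A Y A2 B).testBit w = true) :
    ∃ r₁ r₂ : VRouteData (film C.k) (Wset4 C z ∩ (hexShadow C.k).lift (blkR 4 z tR sR)) (Wset4 C z) (vtx4 C.k z e1) (vtx4 C.k z e2) (vtx4 C.k z w),
      r₁.y = r₂.b ∧ r₁.b = r₂.y := by
  unfold Ctx4.coverOfX at h
  try dsimp only at h
  obtain ⟨hst, h⟩ := of_testBit_cond_not h
  unfold Ctx4.staticX at hst
  try dsimp only at hst
  simp only [Bool.and_eq_true, Bool.or_eq_true, bne_iff_ne, ne_eq, beq_iff_eq] at hst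
  obtain ⟨⟨⟨⟨⟨⟨⟨⟨⟨⟨⟨⟨⟨⟨⟨⟨⟨⟨⟨⟨⟨⟨⟨⟨hne, hyb⟩, hye1⟩, hbe1⟩, hbe2⟩, hc1e2⟩, hc2e2⟩, hye2⟩, hc1⟩, hc2⟩, hyR⟩, hbR⟩, hbW⟩, hc1y⟩, hc1b⟩, hc2y⟩, hc2b⟩,
    hc1ney⟩, hc1neb⟩, hc2ney⟩, hc2neb⟩, hu1⟩, hu2⟩, hWR1⟩, hWR2⟩ := hst
  have hv1 : C.validB e1 = true := (testBit_univ_iff C e1).1 hu1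
  obtain ⟨hval1, h⟩ := of_testBit_cond_not h
  simp only [Bool.and_eq_true] at hval1
  obtain ⟨⟨⟨hA, hAe⟩, hY⟩, hYe⟩ := hval1
  obtain ⟨hval2, h⟩ := of_testBit_cond_not h
  simp only [Bool.and_eq_true] at hval2
  obtain ⟨⟨⟨hA2, hA2e⟩, hB⟩, hBe⟩ := hval2
  rw [Nat.testBit_land, Bool.and_eq_true] at h
  obtain ⟨hg1, hg2⟩ := h
  have hc1' : c1 = e1 ∨ C.WR.testBit c1 = true := by rcases hc1 with h | h; exact Or.inl h; exact Or.inr h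
  have hc2' : c2 = e1 ∨ C.WR.testBit c2 = true := by rcases hc2 with h | h; exact Or.inl h; exact Or.inr h
  obtain ⟨r₁, hr₁y, hr₁b⟩ := routing_sound hz htR hsR hWv hv1 hne hWR2 hc1' hbR hc1y hc1b hA hAe hY hYe hg1
  obtain ⟨r₂, hr₂y, hr₂b⟩ := routing_sound hz htR hsR hWv hv1 hne hWR2 hc2' hyR hc2b hc2y hA2 hA2e hB hBe hg2
  exact ⟨r₁, r₂, by rw [hr₁y, hr₂b], by rw [hr₁b, hr₂y]⟩

/-! ## §3 The node clause for a covered case -/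

/-- **THE NODE CLAUSE OF `ShapedLinkage 4` FOR ONE COVERED CASE.**  For a case context `C` with `CaseOKX C` and an admissible cleared mask
(`C.wOK (allowedM t₁ s₁) (forcedM t₁ s₁)`, `t₁ ≤ t_D`, `s₁ ≤ s_D`, each either exact or `≥ 1`), every block centre `z` of class `C.c0` and all node parameters
the case dominates (`C.tR = min t_R 4`, `C.sR = min s_R 4`, window bounds at least `t_D`, `s_R` or unconstrained): the cleared set `Wset4 C z` lies in
`\overline{blkR 4 z t_D s_D}`, contains every vertex over `hexBall z 1 ∩ blkR 4 z t_D s_D`, and every certified terminal triple has a swap pair of routings.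
[cite: DuminilCopinSidoraviciusTassion2016, §2.3 (proof of Fact 2: the three disjoint paths in B_R(z))] -/
theorem linkage_of_caseOKX (hcase : CaseOKX C) (hk : C.k ≤ 9) (hz : ClassHyp4 C z) {tR tD sR sD : ℕ}
    (htR : C.tR = min tR 4) (hsR : C.sR = min sR 4) (hwT : tD ≤ C.wT ∨ 5 ≤ C.wT) (hwS : sR ≤ C.wS ∨ 5 ≤ C.wS)
    {t1 s1 : ℕ} (ht1 : t1 ≤ tD) (hs1 : s1 ≤ sD) (ht1' : t1 = tD ∨ 1 ≤ t1) (hs1' : s1 = sD ∨ 1 ≤ s1)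
    (hW : C.wOK (C.allowedM t1 s1) (C.forcedM t1 s1) = true) :
    (∀ x ∈ Wset4 C z, (hexShadow C.k).sh x ∈ blkR 4 z tD sD) ∧
      (∀ x, (hexShadow C.k).sh x ∈ hexBall z 1 → (hexShadow C.k).sh x ∈ blkR 4 z tD sD → x ∈ Wset4 C z) ∧
        ∀ (E₁ E₂ w' : slab111 C.k), (hexShadow C.k).Terminals 4 z tR tD sR (Wset4 C z) E₁ E₂ w' →
          ∃ r₁ r₂ : VRouteData (film C.k) (Wset4 C z ∩ (hexShadow C.k).lift (blkR 4 z tR sR)) (Wset4 C z) E₁ E₂ w', r₁.y = r₂.b ∧ r₁.b = r₂.y := by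
  have hW' := hW
  simp only [Ctx4.wOK, Bool.and_eq_true] at hW'
  obtain ⟨hWall, hWfor⟩ := hW'
  have hWv : ∀ i, C.W.testBit i = true → C.validB i = true := by
    intro i hi
    have := of_testBit_maskBelow (testBit_of_sdiff_beq hWall hi)
    simp only [Ctx4.allowedB, Bool.and_eq_true] at this
    exact this.2.1.1.1.1.1.1.1.1
  refine ⟨fun x hx => ?_, fun x h1 hD => ?_, fun E₁ E₂ w' hT => ?_⟩
  · obtain ⟨i, hv, hWi, rfl⟩ := exists_idx_of_mem_Wset hx
    have := of_testBit_maskBelow (testBit_of_sdiff_beq hWall hWi)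
    simp only [Ctx4.allowedB, Bool.and_eq_true, decide_eq_true_eq] at this
    obtain ⟨⟨⟨⟨⟨⟨⟨⟨-, h1⟩, h2⟩, h3⟩, h4⟩, h5⟩, h6⟩, h7⟩, h8⟩ := this.2
    rw [hexShadow_sh]
    exact mem_blkR_of_digits hz hv ht1 hs1 ⟨h1, h2, h3, h4, h5, h6, h7, h8⟩
  · rw [hexShadow_sh] at h1 hD
    obtain ⟨i, hv, rfl⟩ := exists_idx hz hk x (by rw [mem_hexBall] at h1; exact h1.trans (by norm_num))
    obtain ⟨h1, h2, h3, h4, h5, h6, h7, h8⟩ := digits_of_mem_hexBall_one hz hv h1 hD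
    have hf : C.forcedB t1 s1 i = true := by
      simp only [Ctx4.forcedB, hv, Bool.true_and, Bool.and_eq_true, decide_eq_true_eq]
      refine ⟨⟨⟨⟨⟨⟨⟨h1, h2⟩, h3⟩, h4⟩, h5⟩, h6⟩, ?_⟩, ?_⟩
      · rcases ht1' with rfl | h; exact h7; omega
      · rcases hs1' with rfl | h; exact h8; omega
    exact (vtx_mem_Wset_iff hz hv).2 (testBit_of_sdiff_beq hWfor (testBit_maskBelow_of ((validB_iff C i).1 hv).1 hf))
  · obtain ⟨e1, e2, w, hv1, hv2, hvw, rfl, rfl, rfl, -, -, -, he1, he2, hne, hneed⟩ := terminals_sound hz hk htR hsR hwT hwS hT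
    rcases hcase e1 he1 e2 he2 (Ne.symm hne) w hneed with ⟨c1, y, b, c2, av, hcov⟩ | ⟨c1, y, b, c2, A, Y, A2, B, hcov⟩
    · exact coverOf_sound hz htR hsR hWv hcov
    · exact coverOfX_sound hz htR hsR hWv hcov

end Slab111.SK4

end Summit.CriticalPhenomena.PercolationContinuityZ3.Theorems.Transplant

end
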